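import Summits.QuantumFields.BalabanUV.T4Continuum.Support.StarCarrierComponents
import Summits.QuantumFields.BalabanUV.T4Continuum.Support.StarCarrierNeumannPairing
import Summits.QuantumFields.BalabanUV.T4Continuum.Support.AlignedCarrierPairing
import Summits.QuantumFields.BalabanUV.T4Continuum.Support.RegionGaugeResolventSplit
import Mathlib.Algebra.Order.Chebyshev

/-!
# T⁴ programme, spine node NE2 (U1a), sub-row Δ1 «NE2⁰-Dirichlet» — THE SPIKE ROWS OF THE ELECTRIC OPERATOR: the Neumann-defect
# budget `N²·spikeGrad` of (P-gaffney) is a row budget of `W u` plus transverse second differences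

NE2 formalisation swarm `b2b-balaban-t4-ne2-formalise-*`, LEAF PROVER 03 (gen 8), item «W3-GAFFNEY-PAIRING» = (P-gaffney) for the
LOCAL operator (owner R35 (c) / O15-c, journal 2026-08-20 l.22128 / l.22472; CLAIM l.22258), file P5-rows (input of the assembly P5b;
on leaf-01-g10's P4a `StarCarrierComponents` p239836, leaf-02-g8's `RegionElectricSplitting` p238744, P3 `StarCarrierNeumannPairing`
p240386, P2 `AlignedCarrierPairing` p239673).

WHY.  The `N^{−1/2}` wall term of P3's `neumann_pairing_le` is paid against `√spikeGrad z`, `spikeGrad z = Σ_{spike faces} ‖(∂_ν z)(p)‖²`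
(coarse masked gradient on the faces `(p, p + e_ν)` rising from an inward spike `p ∉ Ω`).  For `z = zext ν u` this is NOT an
independent budget: the ROW of the electric operator `W = Σ_μ W_μ` at a spike bond reads (H1, leaf-01-g10's `Wdir_mulVec_apply_eq_Lam` +
`Pneu_mulVec` with `χ(p − e_ν) = 0`, `χ(p) = 1`)
`(W u)(p, ν) = Σ_{μ≠ν} (P_μ z)(p) − N·(∂_ν z)(p)`, so `N²·‖(∂_ν z)(p)‖² ≤ 2(d−1)·Σ_{μ≠ν}‖(P_μ z)(p)‖² + 2·‖(W u)(p,ν)‖²`, and summed: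
**`N²·spikeGrad (zext ν u) ≤ 2(d−1)·Σ_{μ≠ν} budgetOn_{T_ν} μ (zext ν u) + 2·Σ_{b : b.2 = ν} ‖(W u) b‖²`** — transverse gan24 budgets
(already in P5a's `Bc`) plus the component-`ν` share of `nsq (W u)`, both `Ebud`-quantities of the owner's O15-c.

 * §1 `Pneu_zext_apply_spike`, `W_eq_sum_Wdir` (H1: `regionDeltaLoc n M 0 S = Σ_μ Wdir μ`), **`W_row_spike`**;
 * §2 under H1 the non-interior masked faces ARE the spikes (`spike_iff`), `normSq_spike_le`, END **`spikeGrad_le_rows`**.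

HONEST FRAMING (T4-DAG p. 1).  [folklore] bookkeeping; nothing printed is a hypothesis or a conclusion; (P-W) / (L) / `hinjK` / W3 on
boxes OPEN; NE2 (U1a) NOT proved; spine PROVED 0/9 unchanged; NOT [B9] (3.16)/(3.23)–(3.27) as printed; NOT infinite volume, NOT a mass
gap, NOT the Clay problem, NOT summit progress.  HONEST DEPENDENCY: continuum YM on T⁴ ⇐ BetaPertH ∧ nine spine estimates (0/9 proved);
BetaPertH ⇐ (D1) ∧ (D4) ∧ CAP+tail; G-an2-4 gates asym, D1 and NE2/3/4.  No `sorry`.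
-/

noncomputable section

open scoped BigOperators ComplexConjugate Matrix
open Finset

namespace Summit.QuantumFields.BalabanUV.T4Continuum.StarCarrierSpikeRows

open Literature.MathematicalPhysics.QuantumFieldTheory.Balaban1983to89.B5Prop11Plancherel (Tor fine unitVec)
open Literature.MathematicalPhysics.QuantumFieldTheory.Balaban1983to89.B5Action121 (sdiff sdiff_mulVec)
open Literature.MathematicalPhysics.QuantumFieldTheory.Balaban1983to89.B5Prop11Lower (nsq nsq_nonneg)
open Summit.QuantumFields.BalabanUV.Beta.GAN24.DirichletBoxRegularity (Pdir)
open Summit.QuantumFields.BalabanUV.Beta.GAN24.DirichletBoxTrace (blockReg)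
open Summit.QuantumFields.BalabanUV.T4Continuum.RegionGaugeFixedVector (starReg)
open Summit.QuantumFields.BalabanUV.T4Continuum.RegionStarBoundaryCharges (nbr AtMostOneNeighbour)
open Summit.QuantumFields.BalabanUV.T4Continuum.RegionElectricSplitting (Wdir electric_splitting)
open Summit.QuantumFields.BalabanUV.T4Continuum.RegionGaugeResolventSplit (regionDeltaLoc regionDeltaLoc_eq)
open Summit.QuantumFields.BalabanUV.T4Continuum.AlignedCarrierTrace (starSite starSite_iff)
open Summit.QuantumFields.BalabanUV.T4Continuum.AlignedCarrierPairing (budgetOn budgetOn_nonneg)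
open Summit.QuantumFields.BalabanUV.T4Continuum.StarCarrierComponents (zext chi Pneu Lam Pneu_mulVec Wdir_mulVec_apply_eq_Lam)
open Summit.QuantumFields.BalabanUV.T4Continuum.StarCarrierNeumannPairing (bm bsp spikeGrad)

variable {d : ℕ} (N : ℕ) [NeZero N] (M : Fin d → ℕ) [hM : ∀ μ, NeZero (M μ)] (S : Tor M → Prop) [DecidablePred S] (ν : Fin d)

/-! ## §1 The row of the electric operator at a spike bond -/

/-- at a spike `p ∉ Ω`, `p + e_ν ∈ Ω`: `(Pneu_ν z)(p) = −N·(∂_ν z)(p)` (one-sided Neumann row). [folklore] -/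
theorem Pneu_apply_spike (z : Tor (fine N M) → ℂ) {p : Tor (fine N M)} (hp : ¬ blockReg N M S p)
    (hp' : blockReg N M S (p + unitVec (fine N M) ν)) :
    (Pneu N M S ν *ᵥ z) p = -((N : ℂ) * (sdiff (fine N M) (N : ℂ) ν *ᵥ z) p) := by
  have h1 : chi N M S ν p = 1 := by unfold chi; rw [if_pos hp']
  have h2 : chi N M S ν (p - unitVec (fine N M) ν) = 0 := by unfold chi; rw [sub_add_cancel, if_neg hp]
  rw [Pneu_mulVec, h1, h2, sdiff_mulVec]
  ring

/-- under H1 the electric operator is the sum of its directional pieces: `regionDeltaLoc n M 0 S = Σ_μ Wdir μ`. [folklore] -/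
theorem W_eq_sum_Wdir (hH : AtMostOneNeighbour N M S) : regionDeltaLoc N M 0 S = ∑ μ, Wdir N M S μ := by
  rw [regionDeltaLoc_eq, electric_splitting N M S hH, zero_mul, Complex.ofReal_zero, zero_smul, add_zero]

/-- **THE ROW OF `W` AT A SPIKE BOND**: `(W u)(p, ν) = Σ_{μ≠ν} (P_μ z_ν)(p) − N·(∂_ν z_ν)(p)`, `z_ν = zext ν u`. [folklore] -/
theorem W_row_spike (hH : AtMostOneNeighbour N M S) (u : {b // starReg N M S b} → ℂ) {p : Tor (fine N M)}
    (hp : ¬ blockReg N M S p) (hp' : blockReg N M S (p + unitVec (fine N M) ν)) :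
    (regionDeltaLoc N M 0 S *ᵥ u) ⟨(p, ν), Or.inr hp'⟩
      = (∑ μ ∈ univ.erase ν, (Pdir (fine N M) (N : ℂ) μ *ᵥ zext N M S ν u) p)
          - (N : ℂ) * (sdiff (fine N M) (N : ℂ) ν *ᵥ zext N M S ν u) p := by
  rw [W_eq_sum_Wdir N M S hH, Matrix.sum_mulVec, Finset.sum_apply,
    Finset.sum_congr rfl fun μ _ => Wdir_mulVec_apply_eq_Lam N M S hH μ ν u (Or.inr hp'),
    ← Finset.add_sum_erase _ _ (Finset.mem_univ ν)]
  have hν : (Lam N M S ν ν *ᵥ zext N M S ν u) p = -((N : ℂ) * (sdiff (fine N M) (N : ℂ) ν *ᵥ zext N M S ν u) p) := by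
    unfold Lam; rw [if_pos rfl]; exact Pneu_apply_spike N M S ν _ hp hp'
  have hμ : ∀ μ ∈ univ.erase ν, (Lam N M S μ ν *ᵥ zext N M S ν u) p = (Pdir (fine N M) (N : ℂ) μ *ᵥ zext N M S ν u) p := by
    intro μ hμ; unfold Lam; rw [if_neg (Finset.ne_of_mem_erase hμ)]
  rw [hν, Finset.sum_congr rfl hμ]
  ring

/-! ## §2 The spike-row budget -/

/-- under H1 the NON-INTERIOR masked faces are exactly the spikes: `[T y ∧ T(y+e)] ∧ ¬(Ω y ∧ Ω(y+e)) ↔ ¬Ω y ∧ Ω (y+e)`. [folklore] -/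
theorem spike_iff (hH : AtMostOneNeighbour N M S) (y : Tor (fine N M)) :
    ((starSite N M S ν y ∧ starSite N M S ν (y + unitVec (fine N M) ν))
        ∧ ¬ (blockReg N M S y ∧ blockReg N M S (y + unitVec (fine N M) ν)))
      ↔ (¬ blockReg N M S y ∧ blockReg N M S (y + unitVec (fine N M) ν)) := by
  rw [starSite_iff, starSite_iff]
  constructor
  · rintro ⟨⟨h1, h2⟩, h3⟩
    by_cases hy' : blockReg N M S (y + unitVec (fine N M) ν)
    · exact ⟨fun hy => h3 ⟨hy, hy'⟩, hy'⟩
    · exfalso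
      -- `y ∈ Ω` and `y + 2e ∈ Ω`: the exterior site `y + e` has two `ν`-neighbours in `Ω`
      have hy : blockReg N M S y := h1.resolve_right hy'
      have hy2 : blockReg N M S (y + unitVec (fine N M) ν + unitVec (fine N M) ν) := h2.resolve_left hy'
      have := hH (y + unitVec (fine N M) ν) hy' (ν, false) (ν, true)
        (by simp only [nbr, add_sub_cancel_right]; exact hy) (by simp only [nbr]; exact hy2)
      simp at this
  · rintro ⟨h1, h2⟩
    exact ⟨⟨Or.inr h2, Or.inl h2⟩, fun h => h1 h.1⟩

/-- pointwise: `N²·‖(∂_ν z)(p)‖² ≤ 2(d−1)·Σ_{μ≠ν}‖(P_μ z)(p)‖² + 2·‖(W u)(p,ν)‖²` at a spike. [folklore] -/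
theorem normSq_spike_le (hH : AtMostOneNeighbour N M S) (u : {b // starReg N M S b} → ℂ) {p : Tor (fine N M)}
    (hp : ¬ blockReg N M S p) (hp' : blockReg N M S (p + unitVec (fine N M) ν)) :
    (N : ℝ) ^ 2 * ‖(sdiff (fine N M) (N : ℂ) ν *ᵥ zext N M S ν u) p‖ ^ 2
      ≤ 2 * ((univ.erase ν).card : ℝ) * ∑ μ ∈ univ.erase ν, ‖(Pdir (fine N M) (N : ℂ) μ *ᵥ zext N M S ν u) p‖ ^ 2
        + 2 * ‖(regionDeltaLoc N M 0 S *ᵥ u) ⟨(p, ν), Or.inr hp'⟩‖ ^ 2 := by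
  set A := ∑ μ ∈ univ.erase ν, (Pdir (fine N M) (N : ℂ) μ *ᵥ zext N M S ν u) p with hA
  set W := (regionDeltaLoc N M 0 S *ᵥ u) ⟨(p, ν), Or.inr hp'⟩ with hW
  have hrow : (N : ℂ) * (sdiff (fine N M) (N : ℂ) ν *ᵥ zext N M S ν u) p = A - W := by
    rw [hW, W_row_spike N M S ν hH u hp hp']; ring
  have hn : (N : ℝ) ^ 2 * ‖(sdiff (fine N M) (N : ℂ) ν *ᵥ zext N M S ν u) p‖ ^ 2 = ‖A - W‖ ^ 2 := by
    rw [← hrow, norm_mul, Complex.norm_natCast]; ring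
  rw [hn]
  have h1 : ‖A - W‖ ^ 2 ≤ 2 * ‖A‖ ^ 2 + 2 * ‖W‖ ^ 2 := by
    have := norm_sub_le A W
    nlinarith [norm_nonneg A, norm_nonneg W, norm_nonneg (A - W), sq_nonneg (‖A‖ - ‖W‖)]
  have h2 : ‖A‖ ^ 2 ≤ ((univ.erase ν).card : ℝ) * ∑ μ ∈ univ.erase ν, ‖(Pdir (fine N M) (N : ℂ) μ *ᵥ zext N M S ν u) p‖ ^ 2 := by
    refine (pow_le_pow_left₀ (norm_nonneg _) (norm_sum_le _ _) 2).trans ?_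
    exact sq_sum_le_card_mul_sum_sq
  nlinarith [h2]

/-- **THE SPIKE-ROW BUDGET**: `N²·spikeGrad (zext ν u) ≤ 2(d−1)·Σ_{μ≠ν} budgetOn_{T_ν} μ (zext ν u) + 2·Σ_{b : b.2 = ν} ‖(W u) b‖²`. [folklore] -/
theorem spikeGrad_le_rows (hH : AtMostOneNeighbour N M S) (u : {b // starReg N M S b} → ℂ) :
    (N : ℝ) ^ 2 * spikeGrad N M S ν (zext N M S ν u)
      ≤ 2 * ((univ.erase ν).card : ℝ) * ∑ μ ∈ univ.erase ν, budgetOn N M (starSite N M S ν) μ (zext N M S ν u)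
        + 2 * ∑ b ∈ univ.filter (fun b : {b // starReg N M S b} => b.1.2 = ν), ‖(regionDeltaLoc N M 0 S *ᵥ u) b‖ ^ 2 := by
  set z := zext N M S ν u with hz
  -- `spikeGrad z` as a sum over the spikes
  have hsp : spikeGrad N M S ν z = ∑ y ∈ univ.filter (fun y => ¬ blockReg N M S y ∧ blockReg N M S (y + unitVec (fine N M) ν)),
      ‖(sdiff (fine N M) (N : ℂ) ν *ᵥ z) y‖ ^ 2 := by
    rw [spikeGrad, nsq, Finset.sum_filter]
    refine Finset.sum_congr rfl fun y _ => ?_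
    unfold bsp bm
    by_cases h : ¬ blockReg N M S y ∧ blockReg N M S (y + unitVec (fine N M) ν)
    · have h' := (spike_iff N M S ν hH y).mpr h
      rw [if_pos h, if_neg h'.2, if_pos h'.1]
    · rw [if_neg h]
      by_cases hI : blockReg N M S y ∧ blockReg N M S (y + unitVec (fine N M) ν)
      · rw [if_pos hI, norm_zero, zero_pow two_ne_zero]
      · rw [if_neg hI, if_neg (fun hm => h ((spike_iff N M S ν hH y).mp ⟨hm, hI⟩)), norm_zero, zero_pow two_ne_zero]
  rw [hsp, Finset.mul_sum]
  set Sp := univ.filter (fun y => ¬ blockReg N M S y ∧ blockReg N M S (y + unitVec (fine N M) ν)) with hSp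
  -- pointwise rows, summed over the spikes
  have hpt : ∀ y ∈ Sp, (N : ℝ) ^ 2 * ‖(sdiff (fine N M) (N : ℂ) ν *ᵥ z) y‖ ^ 2
      ≤ 2 * ((univ.erase ν).card : ℝ) * ∑ μ ∈ univ.erase ν, ‖(Pdir (fine N M) (N : ℂ) μ *ᵥ z) y‖ ^ 2
        + 2 * (if h : (¬ blockReg N M S y ∧ blockReg N M S (y + unitVec (fine N M) ν))
            then ‖(regionDeltaLoc N M 0 S *ᵥ u) ⟨(y, ν), Or.inr h.2⟩‖ ^ 2 else 0) := by
    intro y hy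
    have h := (Finset.mem_filter.mp hy).2
    rw [dif_pos h]
    exact normSq_spike_le N M S ν hH u h.1 h.2
  refine (Finset.sum_le_sum hpt).trans ?_
  rw [Finset.sum_add_distrib, ← Finset.mul_sum, ← Finset.mul_sum, Finset.sum_comm]
  gcongr with μ hμ
  · -- transverse second differences on the spikes ≤ on the whole carrier
    have hsub : Sp ⊆ univ.filter (starSite N M S ν) := by
      intro y hy
      have h := (Finset.mem_filter.mp hy).2
      exact Finset.mem_filter.mpr ⟨Finset.mem_univ _, (starSite_iff N M S ν y).mpr (Or.inr h.2)⟩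
    refine (Finset.sum_le_sum_of_subset_of_nonneg hsub fun _ _ _ => sq_nonneg _).trans ?_
    rw [budgetOn]
    exact le_add_of_nonneg_left (nsq_nonneg _)
  · -- the rows: re-index the spikes into the star bonds of component `ν`
    -- injective map `y ↦ ⟨(y,ν), _⟩` from the spikes into `{b // b.2 = ν}`
    have key : ∑ y ∈ Sp, (if h : (¬ blockReg N M S y ∧ blockReg N M S (y + unitVec (fine N M) ν))
        then ‖(regionDeltaLoc N M 0 S *ᵥ u) ⟨(y, ν), Or.inr h.2⟩‖ ^ 2 else 0)
        ≤ ∑ b ∈ univ.filter (fun b : {b // starReg N M S b} => b.1.2 = ν), ‖(regionDeltaLoc N M 0 S *ᵥ u) b‖ ^ 2 := by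
      rw [← Finset.sum_fiberwise_of_maps_to (s := univ.filter (fun b : {b // starReg N M S b} => b.1.2 = ν)) (t := univ)
        (g := fun b => b.1.1) (fun _ _ => Finset.mem_univ _)]
      refine (Finset.sum_le_sum_of_subset_of_nonneg (Finset.subset_univ Sp) fun y _ _ => ?_).trans (Finset.sum_le_sum fun y _ => ?_)
      · by_cases h : (¬ blockReg N M S y ∧ blockReg N M S (y + unitVec (fine N M) ν))
        · rw [dif_pos h]; positivity
        · rw [dif_neg h]
      · by_cases h : (¬ blockReg N M S y ∧ blockReg N M S (y + unitVec (fine N M) ν))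
        · rw [dif_pos h]
          have hmem : (⟨(y, ν), Or.inr h.2⟩ : {b // starReg N M S b})
              ∈ (univ.filter (fun b : {b // starReg N M S b} => b.1.2 = ν)).filter (fun b => b.1.1 = y) := by
            simp
          exact Finset.single_le_sum (f := fun b => ‖(regionDeltaLoc N M 0 S *ᵥ u) b‖ ^ 2) (fun _ _ => sq_nonneg _) hmem
        · rw [dif_neg h]; exact Finset.sum_nonneg fun _ _ => sq_nonneg _
    exact key

end Summit.QuantumFields.BalabanUV.T4Continuum.StarCarrierSpikeRows

end
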